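import Summits.ValiantsHypothesis.ValiantsHypothesis.Theorems.BarrierLeverAnchoredDoorHitsLowerPairsDTSKeys

/-!
# Support item `AnchoredDoorHitsLowerPairs` (stmt-ValiantsHypothesis-22510), line `anchored-peeling`:
# the DECOMPOSING DT-STAGE (DTS), part 2 — block-triangularity and the reduction theorem

Helper file (`--supports stmt-ValiantsHypothesis-22510`; cell valiant-natproofs, rung V4, 𝒟-side door (c); registered line
`Cruxes/AnchoredDoorHitsLowerPairs/Lines/anchored_peeling.lean` v10; prover seat val-np-p1 gen 18). Definition-free. Closes NO item.

THE DEVICE (memo HOME/val-np-p1/g18/DTS-MEMO-valnp1-g18.md; keys and peeled rows in `…DTSKeys`). Peel ONE `x`-vertex `a` of the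
layout `(u, w)` with a type list `(B_j, c_j, D_j)_{j<J}` (DT-peel lemma `genDet_ne_zero_of_peel`, p595283), stamps `E_j = {c_j} ⊔ D_j`,
first-fit classes on link rows and first-fit keys on columns. A peeled entry is nonzero only if `colKey ≤ rowKey`
(`colKey_le_rowKey_of_ne_zero`). Under the DTS SIZE CONDITION (as many link rows of class `j` as columns of key `j`, every `j < J`)
a column permutation aligns the keys (`Equiv.ofFiberEquiv`), the peeled matrix is BLOCK-TRIANGULAR (`Matrix.BlockTriangular.det`), and
its diagonal blocks are the layout matrices of the DELETION PAIR `({S ∈ R : a ∉ S}, {T ∈ C : no E_j ⊆ T})` (`det_delBlock_ne_zero`) and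
of the SHIFTED CLASS PAIRS `(𝒰_j, C'_j)`, `𝒰_j = {S ∖ a ∖ B_j : S of class j}`, `C'_j = {T ∖ E_j : T of key j}` (`det_classBlock_ne_zero`).

**THEOREM (`symbolicDet_ne_zero_of_dtsStep`).** If those smaller symbolic minors are nonzero (for all injective enumerations with the
stated ranges), then `symbolicDet s h r u w ≠ 0` (`s ≥ 1`). For a pair of LOWER families every sub-pair is again a lower pair with
fewer rows, so this is an INDUCTION STEP for the line's conjecture U1 (sequel `…DTSStub`: the DTS conjecture ⟹ U1 ⟹ the item).
The one-type case `(∅, c, ∅)` is the `s = 1` star step; full sheds give unit rows; the general first-fit list interpolates.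

WHAT THIS IS NOT: no claim that a decomposing stage exists in general; nothing on items 22510 / 19717 themselves, on crux
stmt-ValiantsHypothesis-14610 or on `VP` versus `VNP`.
-/

set_option linter.dupNamespace false

namespace Summit.ValiantsHypothesis.ValiantsHypothesis.Theorems.BarrierLever.AnchoredPeeling

open Finset MvPolynomial
open Summit.ValiantsHypothesis.ValiantsHypothesis.Theorems.BarrierLever.BrickCalculus (pexpo pexpo_def)

noncomputable section

namespace DTPeel

variable {h : ℕ}

/-! ## 3. The diagonal blocks are symbolic minors of the sub-pairs -/

section Blocks

variable {s r J : ℕ} {u w : Fin r → Finset (Fin h)} {a : Fin h} {B : Fin J → Finset (Fin h)} {c : Fin J → Fin h}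
  {D : Fin J → Finset (Fin h)} {cls : Fin r → Fin J}

/-- The block of class `j < J` is the symbolic minor of an enumeration of the shifted class pair `(𝒰_j, C'_j)`. -/
theorem det_classBlock_ne_zero (hu : Function.Injective u) (hw : Function.Injective w) (haB : ∀ j, a ∉ B j)
    (hcls : ∀ i, a ∈ u i → B (cls i) ⊆ (u i).erase a)
    (hmin : ∀ i, a ∈ u i → ∀ j, j < cls i → ¬ B j ⊆ (u i).erase a)
    (σ : Equiv.Perm (Fin r)) (hσ : ∀ x, colKey w c D (σ x) = rowKey u a cls x) (j : Fin J)
    (hlink : ∀ (r₁ : ℕ) (u₁ w₁ : Fin r₁ → Finset (Fin h)), Function.Injective u₁ → Function.Injective w₁ →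
      Set.range u₁ = {S | a ∉ S ∧ Disjoint S (B j) ∧ insert a (S ∪ B j) ∈ Set.range u ∧ ∀ j', j' < j → ¬ B j' ⊆ S ∪ B j} →
      Set.range w₁ = {T | Disjoint T (stamp c D j) ∧ T ∪ stamp c D j ∈ Set.range w ∧
        ∀ j', j' < j → ¬ stamp c D j' ⊆ T ∪ stamp c D j} →
      symbolicDet s h r₁ u₁ w₁ ≠ 0) :
    (Matrix.of fun x y : {x : Fin r // rowKey u a cls x = (j : ℕ)} =>
      genEntry s h (peelU u a B cls x.1) (peelE u a c D cls x.1) (w (σ y.1))).det ≠ 0 := by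
  classical
  have hxa : ∀ x : {x : Fin r // rowKey u a cls x = (j : ℕ)}, a ∈ u x.1 := fun x => ((rowKey_eq_iff x.1 j).mp x.2).1
  have hxc : ∀ x : {x : Fin r // rowKey u a cls x = (j : ℕ)}, cls x.1 = j := fun x => ((rowKey_eq_iff x.1 j).mp x.2).2
  have hyk : ∀ y : {x : Fin r // rowKey u a cls x = (j : ℕ)}, colKey w c D (σ y.1) = (j : ℕ) := fun y => by
    rw [hσ]; exact y.2
  have hys : ∀ y : {x : Fin r // rowKey u a cls x = (j : ℕ)}, stamp c D j ⊆ w (σ y.1) := fun y =>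
    ((colKey_eq_iff _ j).mp (hyk y)).1
  have hymin : ∀ y : {x : Fin r // rowKey u a cls x = (j : ℕ)}, ∀ j', j' < j → ¬ stamp c D j' ⊆ w (σ y.1) := fun y =>
    ((colKey_eq_iff _ j).mp (hyk y)).2
  have hxB : ∀ x : {x : Fin r // rowKey u a cls x = (j : ℕ)}, B j ⊆ (u x.1).erase a := fun x => by
    have hB := hcls x.1 (hxa x)
    rw [hxc x] at hB
    exact hB
  have hM : (Matrix.of fun x y : {x : Fin r // rowKey u a cls x = (j : ℕ)} =>
        genEntry s h (peelU u a B cls x.1) (peelE u a c D cls x.1) (w (σ y.1))) =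
      Matrix.of fun x y : {x : Fin r // rowKey u a cls x = (j : ℕ)} =>
        coeff (pexpo (((u x.1).erase a) \ B j) (w (σ y.1) \ stamp c D j)) (symbolicWitness s h) := by
    ext x y
    rw [Matrix.of_apply, Matrix.of_apply, peelU_of_mem (hxa x), peelE_of_mem (hxa x), hxc x, genEntry, if_pos (hys y)]
  rw [hM]
  set e := Fintype.equivFin {x : Fin r // rowKey u a cls x = (j : ℕ)} with he
  have h1 : Function.Injective (fun k : Fin (Fintype.card {x : Fin r // rowKey u a cls x = (j : ℕ)}) =>
      ((u (e.symm k).1).erase a) \ B j) := by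
    intro k k' hkk
    have hk : (u (e.symm k).1).erase a = (u (e.symm k').1).erase a := by
      have h2 := congrArg (fun S => S ∪ B j) hkk
      simp only [Finset.sdiff_union_of_subset (hxB _)] at h2
      exact h2
    have hk' : u (e.symm k).1 = u (e.symm k').1 := by
      rw [← Finset.insert_erase (hxa (e.symm k)), ← Finset.insert_erase (hxa (e.symm k')), hk]
    exact e.symm.injective (Subtype.ext (hu hk'))
  have h2 : Function.Injective (fun k : Fin (Fintype.card {x : Fin r // rowKey u a cls x = (j : ℕ)}) =>
      w (σ (e.symm k).1) \ stamp c D j) := by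
    intro k k' hkk
    have hk : w (σ (e.symm k).1) = w (σ (e.symm k').1) := by
      have h2 := congrArg (fun T => T ∪ stamp c D j) hkk
      simp only [Finset.sdiff_union_of_subset (hys _)] at h2
      exact h2
    exact e.symm.injective (Subtype.ext (σ.injective (hw hk)))
  have h3 : Set.range (fun k : Fin (Fintype.card {x : Fin r // rowKey u a cls x = (j : ℕ)}) =>
      ((u (e.symm k).1).erase a) \ B j) =
      {S | a ∉ S ∧ Disjoint S (B j) ∧ insert a (S ∪ B j) ∈ Set.range u ∧ ∀ j', j' < j → ¬ B j' ⊆ S ∪ B j} := by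
    ext S
    constructor
    · rintro ⟨k, rfl⟩
      refine ⟨fun ha => (Finset.notMem_erase a (u (e.symm k).1)) (Finset.sdiff_subset ha), Finset.sdiff_disjoint, ?_, ?_⟩
      · refine ⟨(e.symm k).1, ?_⟩
        simp only [Finset.sdiff_union_of_subset (hxB _), Finset.insert_erase (hxa _)]
      · intro j' hj'
        simp only [Finset.sdiff_union_of_subset (hxB _)]
        have hj'' : j' < cls (e.symm k).1 := by rw [hxc]; exact hj'
        exact hmin _ (hxa (e.symm k)) j' hj''
    · rintro ⟨haS, hdS, ⟨i, hi⟩, hminS⟩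
      have hai : a ∈ u i := hi ▸ Finset.mem_insert_self a _
      have haSB : a ∉ S ∪ B j := by
        rw [Finset.mem_union, not_or]; exact ⟨haS, haB j⟩
      have hera : (u i).erase a = S ∪ B j := by rw [hi, Finset.erase_insert haSB]
      have hci : cls i = j := by
        rcases lt_trichotomy (cls i) j with hlt | heq | hgt
        · exact absurd (hera ▸ hcls i hai) (hminS _ hlt)
        · exact heq
        · exact absurd (hera ▸ Finset.subset_union_right) (hmin i hai j hgt)
      refine ⟨e ⟨i, (rowKey_eq_iff i j).mpr ⟨hai, hci⟩⟩, ?_⟩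
      simp only [Equiv.symm_apply_apply, hera, Finset.union_sdiff_cancel_right hdS]
  have h4 : Set.range (fun k : Fin (Fintype.card {x : Fin r // rowKey u a cls x = (j : ℕ)}) =>
      w (σ (e.symm k).1) \ stamp c D j) =
      {T | Disjoint T (stamp c D j) ∧ T ∪ stamp c D j ∈ Set.range w ∧ ∀ j', j' < j → ¬ stamp c D j' ⊆ T ∪ stamp c D j} := by
    ext T
    constructor
    · rintro ⟨k, rfl⟩
      refine ⟨Finset.sdiff_disjoint, ⟨σ (e.symm k).1, ?_⟩, ?_⟩
      · simp only [Finset.sdiff_union_of_subset (hys _)]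
      · intro j' hj'
        simp only [Finset.sdiff_union_of_subset (hys _)]
        exact hymin _ j' hj'
    · rintro ⟨hdT, ⟨k, hk⟩, hminT⟩
      have hck : colKey w c D k = (j : ℕ) :=
        (colKey_eq_iff k j).mpr ⟨hk ▸ Finset.subset_union_right, fun j' hj' => hk ▸ hminT j' hj'⟩
      have hry : rowKey u a cls (σ.symm k) = (j : ℕ) := by rw [← hσ, Equiv.apply_symm_apply]; exact hck
      refine ⟨e ⟨σ.symm k, hry⟩, ?_⟩
      simp only [Equiv.symm_apply_apply, Equiv.apply_symm_apply, hk, Finset.union_sdiff_cancel_right hdT]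
  have key := hlink _ _ _ h1 h2 h3 h4
  have hsub : symbolicDet s h _ (fun k => ((u (e.symm k).1).erase a) \ B j) (fun k => w (σ (e.symm k).1) \ stamp c D j) =
      ((Matrix.of fun x y : {x : Fin r // rowKey u a cls x = (j : ℕ)} =>
        coeff (pexpo (((u x.1).erase a) \ B j) (w (σ y.1) \ stamp c D j)) (symbolicWitness s h)).submatrix
        e.symm e.symm).det := rfl
  rwa [hsub, Matrix.det_submatrix_equiv_self] at key

/-- The deletion block (key `J`) is the symbolic minor of an enumeration of the deletion pair. -/
theorem det_delBlock_ne_zero (hu : Function.Injective u) (hw : Function.Injective w)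
    (σ : Equiv.Perm (Fin r)) (hσ : ∀ x, colKey w c D (σ x) = rowKey u a cls x) (n : ℕ) (hnJ : n = J)
    (hdel : ∀ (r₀ : ℕ) (u₀ w₀ : Fin r₀ → Finset (Fin h)), Function.Injective u₀ → Function.Injective w₀ →
      Set.range u₀ = {S | S ∈ Set.range u ∧ a ∉ S} → Set.range w₀ = {T | T ∈ Set.range w ∧ ∀ j, ¬ stamp c D j ⊆ T} →
      symbolicDet s h r₀ u₀ w₀ ≠ 0) :
    (Matrix.of fun x y : {x : Fin r // rowKey u a cls x = n} =>
      genEntry s h (peelU u a B cls x.1) (peelE u a c D cls x.1) (w (σ y.1))).det ≠ 0 := by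
  classical
  have hxa : ∀ x : {x : Fin r // rowKey u a cls x = n}, a ∉ u x.1 := fun x => (rowKey_eq_J_iff x.1).mp (x.2.trans hnJ)
  have hyk : ∀ y : {x : Fin r // rowKey u a cls x = n}, ∀ j, ¬ stamp c D j ⊆ w (σ y.1) := fun y =>
    (colKey_eq_J_iff _).mp (by rw [hσ]; exact y.2.trans hnJ)
  have hM : (Matrix.of fun x y : {x : Fin r // rowKey u a cls x = n} =>
        genEntry s h (peelU u a B cls x.1) (peelE u a c D cls x.1) (w (σ y.1))) =
      Matrix.of fun x y : {x : Fin r // rowKey u a cls x = n} =>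
        coeff (pexpo (u x.1) (w (σ y.1))) (symbolicWitness s h) := by
    ext x y
    rw [Matrix.of_apply, Matrix.of_apply, peelU_of_not_mem (hxa x), peelE_of_not_mem (hxa x), genEntry,
      if_pos (Finset.empty_subset _), Finset.sdiff_empty]
  rw [hM]
  set e := Fintype.equivFin {x : Fin r // rowKey u a cls x = n} with he
  have h1 : Function.Injective (fun k : Fin (Fintype.card {x : Fin r // rowKey u a cls x = n}) => u (e.symm k).1) :=
    fun k k' hkk => e.symm.injective (Subtype.ext (hu hkk))
  have h2 : Function.Injective (fun k : Fin (Fintype.card {x : Fin r // rowKey u a cls x = n}) => w (σ (e.symm k).1)) :=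
    fun k k' hkk => e.symm.injective (Subtype.ext (σ.injective (hw hkk)))
  have h3 : Set.range (fun k : Fin (Fintype.card {x : Fin r // rowKey u a cls x = n}) => u (e.symm k).1) =
      {S | S ∈ Set.range u ∧ a ∉ S} := by
    ext S
    constructor
    · rintro ⟨k, rfl⟩
      exact ⟨⟨(e.symm k).1, rfl⟩, hxa (e.symm k)⟩
    · rintro ⟨⟨i, rfl⟩, hi⟩
      exact ⟨e ⟨i, ((rowKey_eq_J_iff i).mpr hi).trans hnJ.symm⟩, by simp only [Equiv.symm_apply_apply]⟩
  have h4 : Set.range (fun k : Fin (Fintype.card {x : Fin r // rowKey u a cls x = n}) => w (σ (e.symm k).1)) =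
      {T | T ∈ Set.range w ∧ ∀ j, ¬ stamp c D j ⊆ T} := by
    ext T
    constructor
    · rintro ⟨k, rfl⟩
      exact ⟨⟨σ (e.symm k).1, rfl⟩, hyk (e.symm k)⟩
    · rintro ⟨⟨k, rfl⟩, hk⟩
      have hck : colKey w c D k = J := (colKey_eq_J_iff k).mpr hk
      have hry : rowKey u a cls (σ.symm k) = n := by rw [← hσ, Equiv.apply_symm_apply, hnJ]; exact hck
      exact ⟨e ⟨σ.symm k, hry⟩, by simp only [Equiv.symm_apply_apply, Equiv.apply_symm_apply]⟩
  have key := hdel _ _ _ h1 h2 h3 h4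
  have hsub : symbolicDet s h _ (fun k => u (e.symm k).1) (fun k => w (σ (e.symm k).1)) =
      ((Matrix.of fun x y : {x : Fin r // rowKey u a cls x = n} =>
        coeff (pexpo (u x.1) (w (σ y.1))) (symbolicWitness s h)).submatrix e.symm e.symm).det := rfl
  rwa [hsub, Matrix.det_submatrix_equiv_self] at key

end Blocks

/-! ## 4. The decomposing DT-stage -/

/-- **THEOREM (decomposing DT-stage, `x`-side).** Peel the `x`-vertex `a` of the layout `(u, w)` (both injective) with the type list
`(B_j, c_j, D_j)_{j<J}` (distinct anchor columns `c_j`, `a ∉ B_j`, `c_j ∉ D_j`) and the first-fit class assignment `cls` on link rows;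
write `E_j = {c_j} ⊔ D_j`. Suppose the DTS SIZE CONDITION: for every `j`, the number of link rows of class `j` equals the number of
columns `T` with `E_j ⊆ T` and `E_{j'} ⊄ T` for all `j' < j`. If the symbolic minors of the DELETION PAIR
`({S ∈ range u : a ∉ S}, {T ∈ range w : no E_j ⊆ T})` and of every SHIFTED CLASS PAIR
`({S : a ∉ S, S ∩ B_j = ∅, S ⊔ a ⊔ B_j ∈ range u, first fit j}, {T : T ∩ E_j = ∅, T ⊔ E_j ∈ range w, first fit j})` are nonzero
(for all injective enumerations with these ranges), then `symbolicDet s h r u w ≠ 0` (`s ≥ 1`). Proof: DT-peel lemma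
(`genDet_ne_zero_of_peel`), a column permutation aligning the first-fit keys (`Equiv.ofFiberEquiv`), `Matrix.BlockTriangular.det`. -/
theorem symbolicDet_ne_zero_of_dtsStep {s r J : ℕ} (hs : 1 ≤ s) (u w : Fin r → Finset (Fin h))
    (hu : Function.Injective u) (hw : Function.Injective w)
    (a : Fin h) (B : Fin J → Finset (Fin h)) (c : Fin J → Fin h) (D : Fin J → Finset (Fin h)) (cls : Fin r → Fin J)
    (hc : Function.Injective c) (haB : ∀ j, a ∉ B j) (hcD : ∀ j, c j ∉ D j)
    (hcls : ∀ i, a ∈ u i → B (cls i) ⊆ (u i).erase a)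
    (hmin : ∀ i, a ∈ u i → ∀ j, j < cls i → ¬ B j ⊆ (u i).erase a)
    (hcount : ∀ j : Fin J, (univ.filter fun i => a ∈ u i ∧ cls i = j).card =
      (univ.filter fun k => insert (c j) (D j) ⊆ w k ∧ ∀ j', j' < j → ¬ insert (c j') (D j') ⊆ w k).card)
    (hdel : ∀ (r₀ : ℕ) (u₀ w₀ : Fin r₀ → Finset (Fin h)), Function.Injective u₀ → Function.Injective w₀ →
      Set.range u₀ = {S | S ∈ Set.range u ∧ a ∉ S} →
      Set.range w₀ = {T | T ∈ Set.range w ∧ ∀ j, ¬ insert (c j) (D j) ⊆ T} →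
      symbolicDet s h r₀ u₀ w₀ ≠ 0)
    (hlink : ∀ (j : Fin J) (r₁ : ℕ) (u₁ w₁ : Fin r₁ → Finset (Fin h)), Function.Injective u₁ → Function.Injective w₁ →
      Set.range u₁ = {S | a ∉ S ∧ Disjoint S (B j) ∧ insert a (S ∪ B j) ∈ Set.range u ∧ ∀ j', j' < j → ¬ B j' ⊆ S ∪ B j} →
      Set.range w₁ = {T | Disjoint T (insert (c j) (D j)) ∧ T ∪ insert (c j) (D j) ∈ Set.range w ∧
        ∀ j', j' < j → ¬ insert (c j') (D j') ⊆ T ∪ insert (c j) (D j)} →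
      symbolicDet s h r₁ u₁ w₁ ≠ 0) :
    symbolicDet s h r u w ≠ 0 := by
  classical
  -- (1) the DT-peel lemma reduces to the peeled generalized layout
  rw [← genDet_empty]
  refine genDet_ne_zero_of_peel hs hc haB hcD u (fun _ => ∅) w cls hcls hmin (fun i _ => Finset.disjoint_empty_left _)
    (peelU u a B cls) (peelE u a c D cls) (fun i => rfl) (fun i => rfl) ?_
  -- (2) a column permutation aligning the keys
  have hfib : ∀ v : ℕ, Fintype.card {i : Fin r // rowKey u a cls i = v} = Fintype.card {k : Fin r // colKey w c D k = v} := by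
    intro v
    rw [Fintype.card_subtype, Fintype.card_subtype]
    exact card_rowKey_eq_card_colKey hcount v
  let σ : Fin r ≃ Fin r :=
    Equiv.ofFiberEquiv (f := rowKey u a cls) (g := colKey w c D) (fun v => Fintype.equivOfCardEq (hfib v))
  have hσ : ∀ x, colKey w c D (σ x) = rowKey u a cls x := fun x => Equiv.ofFiberEquiv_map _ x
  set N : Matrix (Fin r) (Fin r) (MvPolynomial (Param h) ℂ) :=
    Matrix.of fun x y => genEntry s h (peelU u a B cls x) (peelE u a c D cls x) (w (σ y)) with hN
  have hNM : N = (genMatrix s h r (peelU u a B cls) (peelE u a c D cls) w).submatrix id σ := by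
    ext x y; rfl
  intro h0
  have hN0 : N.det = 0 := by
    rw [hNM, Matrix.det_permute', ← genDet, h0, mul_zero]
  -- (3) block-triangularity
  have hBT : N.BlockTriangular (OrderDual.toDual ∘ rowKey u a cls) := by
    intro x y hlt
    have hlt' : rowKey u a cls x < rowKey u a cls y := OrderDual.toDual_lt_toDual.mp hlt
    by_contra hne
    have hle := colKey_le_rowKey_of_ne_zero (u := u) (w := w) (a := a) (B := B) (c := c) (D := D) (cls := cls) s hne
    rw [hσ] at hle
    omega
  rw [Matrix.BlockTriangular.det hBT] at hN0
  obtain ⟨v, hv, hv0⟩ := Finset.prod_eq_zero_iff.mp hN0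
  obtain ⟨x₀, -, hx₀⟩ := Finset.mem_image.mp hv
  subst hx₀
  -- (4) the vanishing block, re-indexed by the plain key
  set n := rowKey u a cls x₀ with hn
  let ε : {x : Fin r // (OrderDual.toDual ∘ rowKey u a cls) x = (OrderDual.toDual ∘ rowKey u a cls) x₀} ≃
      {x : Fin r // rowKey u a cls x = n} :=
    Equiv.subtypeEquivRight (fun x => OrderDual.toDual_inj)
  have hblock : N.toSquareBlock (OrderDual.toDual ∘ rowKey u a cls) ((OrderDual.toDual ∘ rowKey u a cls) x₀) =
      (Matrix.of fun x y : {x : Fin r // rowKey u a cls x = n} =>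
        genEntry s h (peelU u a B cls x.1) (peelE u a c D cls x.1) (w (σ y.1))).submatrix ε ε := by
    ext p q; rfl
  rw [hblock, Matrix.det_submatrix_equiv_self] at hv0
  -- (5) the two kinds of blocks
  rcases lt_or_eq_of_le (rowKey_le (u := u) (a := a) (cls := cls) x₀) with hlt | heq
  · exact det_classBlock_ne_zero hu hw haB hcls hmin σ hσ ⟨n, hlt⟩ (hlink ⟨n, hlt⟩) hv0
  · exact det_delBlock_ne_zero hu hw σ hσ n heq hdel hv0

end DTPeel

end

end Summit.ValiantsHypothesis.ValiantsHypothesis.Theorems.BarrierLever.AnchoredPeeling
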